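import Summits.ResolutionOfSingularities.KangarooAtlas.MizutaniProjectiveOrder
import Summits.ResolutionOfSingularities.KangarooAtlas.MizutaniHironakaDimension
import Literature.AlgebraicGeometry.Resolution.RegularLocalOrderValuation
import HarnessLib

/-!
# Mizutani's conjecture — Hironaka's `U_d(𝔭)` and the invariant additive forms, read in `𝒪_{ℙⁿ,𝔭}`

Cell topic `Summits/ResolutionOfSingularities/KangarooAtlas` (pub-rosobs); namespace
`Summit.ResolutionOfSingularities.KangarooAtlas.Mizutani`.  Companion to `MizutaniProjectiveOrder.lean` (AI-written,
AI-audited; *AI review is weaker than expert review*; not a resolution theorem).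

`MizutaniProjectiveOrder.lean` proves, for every homogeneous prime `𝔭 ⊂ S = k[X_0, …, X_n]` and every linear form
`ℓ ∉ 𝔭`, that a form `φ` of degree `m` lies in the symbolic power `symbPow k 𝔭 d = 𝔭^d S_𝔭 ∩ S` (the res-hironaka
transcription of «`mult_𝔭 φ ≥ d`», `Literature/…/HironakaGroupSchemeMultiplicity.lean`) iff its germ `φ/ℓ^m` lies in
the `d`-th power of the maximal ideal of the projective local ring `𝒪_{Proj S,𝔭}`
(`HomogeneousLocalization.AtPrime`).  This file specialises to POINTS of `ℙⁿ_k` (tree `IsPoint`: homogeneous primes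
`𝔭 ⊉ S_+`), where a variable `X_i ∉ 𝔭` is available (`exists_X_not_mem_of_isPoint`), and records:

* `mem_symbPow_iff_le_adicOrder_projGerm` — with the tree's `𝔪`-adic order `adicOrder` (`ν(a) = sup {d | a ∈ 𝔪^d}`,
  `Literature/…/RegularLocalOrderValuation.lean`): `φ ∈ symbPow k 𝔭 d ↔ d ≤ ν(φ/ℓ^m)`, Hironaka's inequality
  `ν_{x'}(φ/X_0^d) ≥ d` as printed;
* `mem_symbPow_iff_projGerm_X_mem_pow`, `mem_multGens_iff_projGerm` — Hironaka's [H4] p. 154 L24–29 definition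
  «`U` … whose homogeneous part of degree `d` is `{φ ∈ K[X]_d | ν_{x'}(φ/X_0^d) ≥ d}`» VERBATIM: the homogeneous
  generators `multGens k 𝔭` of the tree's `multAlgebra k 𝔭 = U(𝔭)` are the forms `φ ∈ S_d` with
  `φ/X_i^d ∈ 𝔪_{ℙⁿ,𝔭}^d`;
* `mem_hirForms_iff_projGerm_mem_pow` — Hironaka's/Mizutani's invariant additive forms `U(𝔭) ∩ L_e` (`hirForms`):
  `h = Σ a_j X_j^{p^e}` with `h/X_i^{p^e} ∈ 𝔪_{ℙⁿ,𝔭}^{p^e}`;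
* `mem_invForms_iff_projGerm_mem_pow` — by ODA'S EQUALITY (`hirForms_eq_invForms`, `MizutaniOdaEquality.lean`) the
  same holds for Oda's printed `(L_B)_e` (`invForms`): Oda's coefficient-differential-operator description (Publ.
  RIMS 19 p. 1168) and Hironaka's order description ([H4] p. 154) name the same forms, as a theorem of the tree.

With this, the only non-formal steps left between the tree's objects and the printed definitions are: «the
multiplicity of the hypersurface `f = 0` at `p` is the order of `f` in the regular local ring `𝒪_{ℙⁿ,p}`» (Samuel
multiplicity vs. order; Hironaka [H4] writes the order `ν`, Mizutani p. 85 writes `mult`) and Mizutani's Def. 1.1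
`B_{P,𝔭} := Spec(S/U_+(𝔭)S)` itself.

References: [Hironaka1970NumericalCharacters] p. 154 L24–29; [Mizutani1973HironakaGroupSchemes] p. 85 L21–29, §1 (c),
Def. 1.1; [Oda1983HironakaGroupSchemeII] §2 p. 1168.
-/

noncomputable section

open MvPolynomial DirectSum Literature.AlgebraicGeometry.Resolution
  Literature.AlgebraicGeometry.Resolution.HironakaScheme

attribute [local instance] MvPolynomial.gradedAlgebra

namespace Summit.ResolutionOfSingularities.KangarooAtlas.Mizutani

universe u

section ProjectiveOrderPoint

variable {k : Type u} [Field k] {n : ℕ}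
  (𝔭 : Ideal (MvPolynomial (Fin (n + 1)) k)) [h𝔭 : 𝔭.IsPrime]

/-! ### Hironaka's `ν_{x'}(φ/ℓ^m) ≥ d` with the order function -/

variable {𝔭} in
/-- **`φ ∈ 𝔭^{(d)} ⟺ ν(φ/ℓ^m) ≥ d`**, `ν` the `𝔪`-adic order of the local ring `𝒪_{Proj S,𝔭}` (the tree's `adicOrder`,
`ν(a) = sup {d | a ∈ 𝔪^d} ∈ ℕ∞`): Hironaka's printed inequality `ν_{x'}(φ/X_0^d) ≥ d` ([H4] p. 154 L27, with `ν_{x'}`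
the order function of `𝒪_{Proj K[X],x'}`), for every homogeneous prime `𝔭`, linear form `ℓ ∉ 𝔭`, form `φ` of
degree `m` and every `d`. [cite: Hironaka1970NumericalCharacters, p. 154 L24–29] -/
theorem mem_symbPow_iff_le_adicOrder_projGerm {ℓ : MvPolynomial (Fin (n + 1)) k}
    (hℓ : ℓ ∈ homogeneousSubmodule (Fin (n + 1)) k 1) (hℓ𝔭 : ℓ ∉ 𝔭)
    (h𝔭h : 𝔭.IsHomogeneous (homogeneousSubmodule (Fin (n + 1)) k)) {m : ℕ}
    (φ : MvPolynomial (Fin (n + 1)) k) (hφ : φ ∈ homogeneousSubmodule (Fin (n + 1)) k m) (d : ℕ) :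
    φ ∈ symbPow k 𝔭 d ↔ (d : ℕ∞) ≤ adicOrder (projGerm 𝔭 ℓ hℓ hℓ𝔭 m φ hφ) := by
  rw [le_adicOrder_iff]
  exact mem_symbPow_iff_projGerm_mem_pow hℓ hℓ𝔭 h𝔭h φ hφ d

/-! ### Points of `ℙⁿ`: the chart `X_i ≠ 0` -/

omit h𝔭 in
/-- A point of `ℙⁿ_k` (tree `IsPoint`: homogeneous prime `𝔭 ⊉ S_+`) misses some variable: `X_i ∉ 𝔭`
(Hironaka: «`x'` viewed as a point of `Proj(K[X])`», coordinates with `X_0(x') ≠ 0`). [cite: Hironaka1970NumericalCharacters, p. 154 L24–29] -/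
theorem exists_X_not_mem_of_isPoint (hP : IsPoint k 𝔭) :
    ∃ i : Fin (n + 1), (X i : MvPolynomial (Fin (n + 1)) k) ∉ 𝔭 := by
  by_contra hall
  push Not at hall
  exact hP.2.2 (irrelevant_le_of_X_mem k hall)

omit h𝔭 in
/-- A point of `ℙⁿ_k` is a homogeneous ideal for the grading by degree. [folklore] -/
theorem isHomogeneous_of_isPoint (hP : IsPoint k 𝔭) :
    𝔭.IsHomogeneous (homogeneousSubmodule (Fin (n + 1)) k) := by
  intro i r hr
  have e : ((decompose (homogeneousSubmodule (Fin (n + 1)) k) r) i : MvPolynomial (Fin (n + 1)) k) =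
      homogeneousComponent i r :=
    MvPolynomial.decomposition.decompose'_apply r i
  rw [e]
  exact hP.2.1 r hr i

variable {𝔭}

/-- **Hironaka's `U_d(𝔭)` verbatim** ([H4] p. 154 L24–29: «the graded `K`-subalgebra of `K[X]` whose homogeneous
part of degree `d` is `{φ ∈ K[X]_d | ν_{x'}(φ/X_0^d) ≥ d}`»): for a point `𝔭` of `ℙⁿ_k` and a variable `X_i ∉ 𝔭`,
a form `φ` of degree `d` lies in the tree's `symbPow k 𝔭 d` (the transcription used by `multGens`/`multAlgebra`/
`bIdeal`, i.e. by `B_{P,𝔭}`) iff its germ `φ/X_i^d` lies in the `d`-th power of the maximal ideal of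
`𝒪_{ℙⁿ,𝔭} = 𝒪_{Proj S,𝔭}`.
[cite: Hironaka1970NumericalCharacters, p. 154 L24–29; Mizutani1973HironakaGroupSchemes, p. 85 L21–25 (U(p), U_m(p))] -/
theorem mem_symbPow_iff_projGerm_X_mem_pow (hP : IsPoint k 𝔭) {i : Fin (n + 1)}
    (hi : (X i : MvPolynomial (Fin (n + 1)) k) ∉ 𝔭) {d : ℕ} (φ : MvPolynomial (Fin (n + 1)) k)
    (hφ : φ ∈ homogeneousSubmodule (Fin (n + 1)) k d) :
    φ ∈ symbPow k 𝔭 d ↔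
      projGerm 𝔭 (X i) (isHomogeneous_X k i) hi d φ hφ ∈
        IsLocalRing.maximalIdeal (HomogeneousLocalization.AtPrime (homogeneousSubmodule (Fin (n + 1)) k) 𝔭) ^ d :=
  mem_symbPow_iff_projGerm_mem_pow _ hi (isHomogeneous_of_isPoint 𝔭 hP) φ hφ d

/-- The same with the order function: for a point `𝔭` of `ℙⁿ_k`, `X_i ∉ 𝔭` and a form `φ` of degree `d`,
`φ ∈ symbPow k 𝔭 d ↔ d ≤ ν(φ/X_i^d)` — «`ν_{x'}(φ/X_0^d) ≥ d`», [H4] p. 154 L27, symbol for symbol.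
[cite: Hironaka1970NumericalCharacters, p. 154 L24–29] -/
theorem mem_symbPow_iff_le_adicOrder_projGerm_X (hP : IsPoint k 𝔭) {i : Fin (n + 1)}
    (hi : (X i : MvPolynomial (Fin (n + 1)) k) ∉ 𝔭) {d : ℕ} (φ : MvPolynomial (Fin (n + 1)) k)
    (hφ : φ ∈ homogeneousSubmodule (Fin (n + 1)) k d) :
    φ ∈ symbPow k 𝔭 d ↔
      (d : ℕ∞) ≤ adicOrder (projGerm 𝔭 (X i) (isHomogeneous_X k i) hi d φ hφ) :=
  mem_symbPow_iff_le_adicOrder_projGerm _ hi (isHomogeneous_of_isPoint 𝔭 hP) φ hφ d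

/-- Hence the homogeneous generators `multGens k 𝔭` of Hironaka's `U(𝔭)` are exactly the forms `φ` of some degree
`d` with `φ/X_i^d ∈ 𝔪_{ℙⁿ,𝔭}^d`. [cite: Hironaka1970NumericalCharacters, p. 154 L24–29; Mizutani1973HironakaGroupSchemes, p. 85 L21–25] -/
theorem mem_multGens_iff_projGerm (hP : IsPoint k 𝔭) {i : Fin (n + 1)}
    (hi : (X i : MvPolynomial (Fin (n + 1)) k) ∉ 𝔭) (φ : MvPolynomial (Fin (n + 1)) k) :
    φ ∈ multGens k 𝔭 ↔
      ∃ (d : ℕ) (hφ : φ ∈ homogeneousSubmodule (Fin (n + 1)) k d),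
        projGerm 𝔭 (X i) (isHomogeneous_X k i) hi d φ hφ ∈
          IsLocalRing.maximalIdeal
            (HomogeneousLocalization.AtPrime (homogeneousSubmodule (Fin (n + 1)) k) 𝔭) ^ d := by
  constructor
  · rintro ⟨d, hφd, hφ⟩
    have hφ' : φ ∈ homogeneousSubmodule (Fin (n + 1)) k d := (mem_homogeneousSubmodule d φ).mpr hφd
    exact ⟨d, hφ', (mem_symbPow_iff_projGerm_X_mem_pow hP hi φ hφ').mp hφ⟩
  · rintro ⟨d, hφ', hφ⟩
    exact ⟨d, (mem_homogeneousSubmodule d φ).mp hφ', (mem_symbPow_iff_projGerm_X_mem_pow hP hi φ hφ').mpr hφ⟩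

/-! ### The invariant additive forms, read in `𝒪_{ℙⁿ,𝔭}` -/

omit h𝔭 in
/-- An additive form `Σ a_j X_j^{p^e}` is a form of degree `p^e`. [cite: Oda1983HironakaGroupSchemeII, §2 (p. 1167–1168: L_e ⊂ S_{p^e})] -/
theorem addForm_mem_homogeneousSubmodule (p : ℕ) [Fact p.Prime] [CharP k p] (e : ℕ) (a : Fin (n + 1) → k) :
    addForm k p e a ∈ homogeneousSubmodule (Fin (n + 1)) k (p ^ e) :=
  (mem_homogeneousSubmodule (p ^ e) _).mpr (isHomogeneous_addForm k p e a)

/-- **Hironaka's/Mizutani's invariant additive forms `U(𝔭) ∩ L_e`, read in the projective local ring**: for a point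
`𝔭` of `ℙⁿ_k` and a variable `X_i ∉ 𝔭`, a coefficient vector `a` lies in `hirForms k p 𝔭 e` (the additive form
`h = Σ a_j X_j^{p^e}` has multiplicity `≥ p^e` at `𝔭`, tree reading `h ∈ 𝔭^{(p^e)}`) iff `h/X_i^{p^e} ∈ 𝔪_{ℙⁿ,𝔭}^{p^e}`
(`ν_𝔭(h/X_i^{p^e}) ≥ p^e = deg h`, [H4] p. 154; [Miz] §1 (c) `U(p) ∩ L`).
[cite: Hironaka1970NumericalCharacters, p. 154 L24–29; Mizutani1973HironakaGroupSchemes, §1 Def. 1.1 and (c) p. 85–86] -/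
theorem mem_hirForms_iff_projGerm_mem_pow (p : ℕ) [Fact p.Prime] [CharP k p] (hP : IsPoint k 𝔭)
    {i : Fin (n + 1)} (hi : (X i : MvPolynomial (Fin (n + 1)) k) ∉ 𝔭) (e : ℕ) (a : Fin (n + 1) → k) :
    a ∈ hirForms k p 𝔭 e ↔
      projGerm 𝔭 (X i) (isHomogeneous_X k i) hi (p ^ e) (addForm k p e a)
          (addForm_mem_homogeneousSubmodule p e a) ∈
        IsLocalRing.maximalIdeal
          (HomogeneousLocalization.AtPrime (homogeneousSubmodule (Fin (n + 1)) k) 𝔭) ^ p ^ e :=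
  (mem_hirForms_iff).trans (mem_symbPow_iff_projGerm_X_mem_pow hP hi _ _)

/-- **… and, by ODA'S EQUALITY (`hirForms_eq_invForms`), the same for Oda's printed `(L_B)_e`**: for a point `𝔭` of
`ℙⁿ_k`, `X_i ∉ 𝔭`, a coefficient vector `a` satisfies Oda's differential-operator condition (`invForms`, Oda 1983-II
p. 1168) iff `(Σ a_j X_j^{p^e})/X_i^{p^e}` has order `≥ p^e` in `𝒪_{ℙⁿ,𝔭}` — Oda's description and Hironaka's [H4]
definition name the same forms, as a theorem of the tree.
[cite: Oda1983HironakaGroupSchemeII, §2 (p. 1168, (L_B)_e after [O_1] Prop. 2.2 (ii)); Hironaka1970NumericalCharacters, p. 154 L24–29] -/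
theorem mem_invForms_iff_projGerm_mem_pow (p : ℕ) [Fact p.Prime] [CharP k p] (hP : IsPoint k 𝔭)
    {i : Fin (n + 1)} (hi : (X i : MvPolynomial (Fin (n + 1)) k) ∉ 𝔭) (e : ℕ) (a : Fin (n + 1) → k) :
    a ∈ invForms k p 𝔭 e ↔
      projGerm 𝔭 (X i) (isHomogeneous_X k i) hi (p ^ e) (addForm k p e a)
          (addForm_mem_homogeneousSubmodule p e a) ∈
        IsLocalRing.maximalIdeal
          (HomogeneousLocalization.AtPrime (homogeneousSubmodule (Fin (n + 1)) k) 𝔭) ^ p ^ e := by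
  rw [← hirForms_eq_invForms 𝔭 e]
  exact mem_hirForms_iff_projGerm_mem_pow p hP hi e a

end ProjectiveOrderPoint

end Summit.ResolutionOfSingularities.KangarooAtlas.Mizutani

end
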